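import Summits.Ventures.CertifiedManyBodySolver.Upper.IntervalReaderSourcedTwoFieldNode
import Literature.MathematicalPhysics.QuantumLattice.FrozenEnvironmentEmbedding

/-!
# Ventures/CertifiedManyBodySolver — Upper/IntervalReaderEmbedLayout.lean: the EMBED layout of `l3core-sgf`, I —
# the dilation of the orbitals, the un-dilated witness, the dilated operators (part 33 of the Theorem-H1′ package;
# parts 1–32: `IntervalReaderSchur` … `IntervalReaderSourcedTwoFieldNode`; parts 34/35: `IntervalReaderEmbedWordSums`,
# `IntervalReaderEmbedClaimNode`)

HONEST FRAMING: first certified bounds; not a superconductivity verdict; every number certified (two readers)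
or labelled float.  A sourced-Hamiltonian upper is a certified variational ENERGY CEILING for
`H − μN − h(Δ_d + Δ_d†)` on one finite box together with windows of the SAME vector; it is never a sign of order and
never an order-parameter word (LADDER v1.17 (i)).  This file is a DICTIONARY between two layouts of one reader; it
certifies no number and moves no row.

THE GAP (ref-2c g27 RESULT 2, precision P6).  Parts 31/32 state the W5 claim node for the MERGE layout of ird-3's
`l3core-sgf` (`sgf_read.py`, `JOB_LAYOUT=merge`): the sweep runs over `a·b` sites of local dimension 4, site `x` = the
mode pair `(x↑, x↓)` of the transformed frame.  Every read of record is the EMBED layout (`JOB_LAYOUT=embed`, the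
production default, `sgf_model.ModeQuadModel.dilated` + `sgf_adapter.embed_modes`): the certificate's `K = 2ab`
spin-orbital tensors are placed on `2ab` l3core sites of local dimension 4 whose SECOND mode is a never-occupied DUMMY
(«no term touches them; channels pass Z / I through them, and Z|0⟩ = |0⟩»), so the bytes of record (the last `FINAL`
environments, radii, `Nrm`) are those of a `2ab`-site sweep whose CROSS-site words now include what the merge layout
keeps on site (the intra-site one-body word and `−U·n_{x↑}ñ_{x↓}`).  Parts 33–35 prove that those bytes imply the SAME
five- and seven-conjunct claim nodes, through the tree's frozen-environment embedding of Fock spaces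
(`Literature/…/FrozenEnvironmentEmbedding`: `frozenEmbed`, `jwEmbed_mul_frozenEmbed`).

THIS FILE (Fock side + the reader's generic window):
* §D the dilation `dilOrb : Orb Λ ↪o Orb (Orb Λ)`, `i ↦ (i, 0)` (dilated site set `Orb Λ`, dummies = the spin-`1`
  orbitals), the un-dilated witness `undilate e′ ψ` of a chain vector `ψ` read along an enumeration
  `e′ : Fin N ≃ Orb Λ` of the dilated sites, and `V_∅ (undilate e′ ψ) = toSpinVec⁻¹ (ψ ∘ e′)` as soon as `ψ` vanishes
  whenever a dummy is occupied (`frozenEmbed_undilate`; for the reader's witness: the zero slices `A′ j 2 = A′ j 3 = 0`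
  of the embedded tensors, `mpsOpenVar_eq_zero_of_dummy`) ⟹ matrix elements, norms and the particle number transport
  (`undilate_sandwich`, `undilate_norm`, `isNParticle_undilate`);
* §Q `Γ(dilOrb)` (`jwEmbed dilOrb`) of `dΓ(M)`, of `n_{xσ}`, of the transformed quadratic operator
  `dΓ(M) − μ·ab·1 + U(N_↑ − Σ n_↑n_↓)` and of the transformed number `ab·1 + Σ (n_↑ − n_↓)` (`dilMatrix`,
  `jwEmbed_dilOrb_quadratic`, `jwEmbed_dilOrb_number`);
* §R the reader's one-sided sentence / two-sided window for an ARBITRARY word sum `quadWordSum τ ν V` on a chain of any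
  length (`wordSum_sentence_of_reader`, `wordSum_window_of_reader`: part 20's `reader_encloses_quadWordSum_element` +
  part 12's norm enclosure + part 3's `accept_sound` / part 23's `lower_sound`).
-/

noncomputable section

-- The dilated orbital type `Orb (Orb Λ)` is a twice-nested `Lex` synonym; its `DecidableEq` / `Fintype` instance
-- terms exceed the default answer size of instance synthesis (they are found, but discarded), hence:
set_option synthInstance.maxSize 1024

open Matrix Finset WithLp
open scoped BigOperators ComplexOrder Matrix.Norms.L2Operator

namespace Summit.Ventures.CertifiedManyBodySolver.Upper.IntervalReader

open Literature.MathematicalPhysics.QuantumLattice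
open Literature.MathematicalPhysics.QuantumLattice.JordanWigner
open Literature.MathematicalPhysics.QuantumLattice.JWEmbed
open Literature.MathematicalPhysics.QuantumLattice.TwoCluster (HasParity)

/-! ## §D  The dilation of the orbitals and the un-dilated witness -/

section Dilation

variable {Λ : Type*} [LinearOrder Λ]

/-- **The dilation**: orbital `i` of `Λ` ↦ the spin-`0` orbital `(i, 0)` of the dilated site `i` (dilated site set
`Orb Λ`, linearly ordered site-major; the spin-`1` orbitals `(i, 1)` are the reader's dummies).  An order embedding. -/
def dilOrb : Orb Λ ↪o Orb (Orb Λ) :=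
  OrderEmbedding.ofMapLEIff (fun i : Orb Λ => orb i 0) fun i j => by
    show toLex (i, (0 : Fin 2)) ≤ toLex (j, (0 : Fin 2)) ↔ i ≤ j
    rw [Prod.Lex.toLex_le_toLex]
    constructor
    · rintro (h | ⟨h, -⟩)
      exacts [h.le, h.le]
    · intro h
      rcases h.lt_or_eq with h | h
      exacts [Or.inl h, Or.inr ⟨h, le_rfl⟩]

/-- `dilOrb i = (i, 0)`. -/
@[simp] theorem dilOrb_apply (i : Orb Λ) : dilOrb i = orb i 0 := rfl

variable [Fintype Λ]

/-- The image of the dilation is the set of spin-`0` orbitals of the dilated lattice. -/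
theorem mem_rangeF_dilOrb {o : Orb (Orb Λ)} : o ∈ rangeF (dilOrb (Λ := Λ)) ↔ (ofLex o).2 = 0 := by
  rw [mem_rangeF]
  constructor
  · rintro ⟨i, rfl⟩
    rfl
  · intro h
    refine ⟨(ofLex o).1, ?_⟩
    rw [dilOrb_apply, orb, ← h]
    rfl

/-- A dilated configuration has empty environment iff no dummy orbital `(i, 1)` is occupied. -/
theorem env_dilOrb_eq_empty_iff {u' : Finset (Orb (Orb Λ))} :
    env (dilOrb (Λ := Λ)) u' = ∅ ↔ ∀ i : Orb Λ, orb i 1 ∉ u' := by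
  rw [Finset.eq_empty_iff_forall_notMem]
  constructor
  · intro h i hi
    refine h (orb i 1) ?_
    rw [mem_env, mem_rangeF_dilOrb]
    exact ⟨hi, by simp [orb]⟩
  · intro h o ho
    rw [mem_env, mem_rangeF_dilOrb] at ho
    obtain ⟨ho, hs⟩ := ho
    have hs1 : (ofLex o).2 = 1 := by
      rcases Fin.exists_fin_two.mp ⟨(ofLex o).2, rfl⟩ with h0 | h1
      · exact absurd h0 hs
      · exact h1
    refine h (ofLex o).1 ?_
    rw [orb, ← hs1]
    exact ho

omit [Fintype Λ] in
/-- The frozen-environment sign of the EMPTY environment is `1` (the embedding `V_∅` is sign-free). -/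
theorem transSign_empty_env (X : Finset (Orb Λ)) : transSign (dilOrb (Λ := Λ)) ∅ X = 1 := by
  simp [transSign, envSign]

variable {N : ℕ}

/-- **The un-dilated witness.**  A chain vector `ψ` read on the dilated lattice along `e′ : Fin N ≃ Orb Λ`
(`Ψ′ k = ψ (k ∘ e′)`, a vector on `TensorIndex (Orb Λ) 4`) restricted to the dummy-empty configurations and pulled
back to the Fock space of `Λ`: `(undilate e′ ψ) u = (toSpinVec⁻¹ Ψ′) (dilOrb u)`. -/
def undilate (e' : Fin N ≃ Orb Λ) (ψ : TensorIndex (Fin N) 4 → ℂ) : Fock (Orb Λ) :=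
  fun u => ψ fun j => siteConfig (combine dilOrb u ∅) (e' j)

omit [Fintype Λ] in
/-- A dummy orbital is occupied in `u′` iff the local state of its dilated site carries spin `1`. -/
theorem orb_one_mem_iff_siteConfig (u' : Finset (Orb (Orb Λ))) (i : Orb Λ) :
    orb i 1 ∈ u' ↔ (1 : Fin 2) ∈ siteOcc (siteConfig u' i) := by
  rw [siteOcc_siteConfig, localOcc, Finset.mem_filter]
  simp

/-- **`V_∅ (undilate e′ ψ) = toSpinVec⁻¹ Ψ′`** as soon as `ψ` vanishes on every configuration with an occupied dummy. -/
theorem frozenEmbed_undilate (e' : Fin N ≃ Orb Λ) (ψ : TensorIndex (Fin N) 4 → ℂ)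
    (hψ : ∀ σ : TensorIndex (Fin N) 4, (∃ j, (1 : Fin 2) ∈ siteOcc (σ j)) → ψ σ = 0) :
    frozenEmbed dilOrb ∅ *ᵥ undilate e' ψ =
      toSpinVec.symm (fun k : TensorIndex (Orb Λ) 4 => ψ fun j => k (e' j)) := by
  funext u'
  rw [frozenEmbed_mulVec_apply, toSpinVec_symm_apply]
  by_cases h : env dilOrb u' = ∅
  · rw [if_pos h, transSign_empty_env, one_mul, undilate, ← h, combine_pre_env]
  · rw [if_neg h]
    symm
    apply hψ
    obtain ⟨i, hi⟩ : ∃ i : Orb Λ, orb i 1 ∈ u' := by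
      by_contra hne
      exact h (env_dilOrb_eq_empty_iff.mpr fun i hi => hne ⟨i, hi⟩)
    refine ⟨e'.symm i, ?_⟩
    rw [Equiv.apply_symm_apply]
    exact (orb_one_mem_iff_siteConfig u' i).mp hi

/-- **Matrix elements transport**: `⟨ψ̃, X ψ̃⟩ = ⟨toSpinVec⁻¹Ψ′, Γ(dilOrb)(X) toSpinVec⁻¹Ψ′⟩` for `ψ̃ = undilate e′ ψ`
(`jwEmbed_mul_frozenEmbed`: the frozen block is a copy of the defining representation). -/
theorem undilate_sandwich (e' : Fin N ≃ Orb Λ) (ψ : TensorIndex (Fin N) 4 → ℂ)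
    (hψ : ∀ σ : TensorIndex (Fin N) 4, (∃ j, (1 : Fin 2) ∈ siteOcc (σ j)) → ψ σ = 0)
    (X : Matrix (Finset (Orb Λ)) (Finset (Orb Λ)) ℂ) :
    star (undilate e' ψ) ⬝ᵥ (X *ᵥ undilate e' ψ) =
      star (toSpinVec.symm (fun k : TensorIndex (Orb Λ) 4 => ψ fun j => k (e' j))) ⬝ᵥ
        (jwEmbed dilOrb X *ᵥ toSpinVec.symm (fun k : TensorIndex (Orb Λ) 4 => ψ fun j => k (e' j))) := by
  have hdis : Disjoint (∅ : Finset (Orb (Orb Λ))) (rangeF (dilOrb (Λ := Λ))) := Finset.disjoint_empty_left _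
  have hVX := jwEmbed_mul_frozenEmbed (dilOrb (Λ := Λ)) hdis X
  rw [← frozenEmbed_undilate e' ψ hψ, mulVec_mulVec, hVX, ← mulVec_mulVec,
    star_frozenEmbed_mulVec_dotProduct (dilOrb (Λ := Λ)) hdis]

/-- **Norms transport**: `⟨ψ̃, ψ̃⟩ = ⟨ψ, ψ⟩`. -/
theorem undilate_norm (e' : Fin N ≃ Orb Λ) (ψ : TensorIndex (Fin N) 4 → ℂ)
    (hψ : ∀ σ : TensorIndex (Fin N) 4, (∃ j, (1 : Fin 2) ∈ siteOcc (σ j)) → ψ σ = 0) :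
    star (undilate e' ψ) ⬝ᵥ undilate e' ψ = star ψ ⬝ᵥ ψ := by
  have h := undilate_sandwich e' ψ hψ 1
  rw [one_mulVec, map_one, one_mulVec] at h
  rw [h, ← star_toSpinVec_dotProduct (toSpinVec.symm _), LinearEquiv.apply_symm_apply, star_compEquiv_dotProduct]

/-- **Particle number transports**: the un-dilated witness lies in the `Ñ`-particle sector when `toSpinVec⁻¹Ψ′` does
(`|dilOrb u| = |u|`). -/
theorem isNParticle_undilate (e' : Fin N ≃ Orb Λ) (ψ : TensorIndex (Fin N) 4 → ℂ) {Nt : ℕ}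
    (h : IsNParticle Nt (toSpinVec.symm (fun k : TensorIndex (Orb Λ) 4 => ψ fun j => k (e' j)))) :
    IsNParticle Nt (undilate e' ψ) := by
  intro u hu
  have hdis : Disjoint (∅ : Finset (Orb (Orb Λ))) (rangeF (dilOrb (Λ := Λ))) := Finset.disjoint_empty_left _
  have hcard : (combine (dilOrb (Λ := Λ)) u ∅).card = u.card := by
    rw [card_combine (dilOrb (Λ := Λ)) hdis, Finset.card_empty, add_zero]
  have := h (combine dilOrb u ∅) (by rw [hcard]; exact hu)
  rwa [toSpinVec_symm_apply] at this

variable {D : ℕ}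

/-- The local states with an occupied dummy are `|↓⟩ = 2` and `|↑↓⟩ = 3`. -/
theorem one_mem_siteOcc_iff (s : Fin 4) : (1 : Fin 2) ∈ siteOcc s ↔ s = 2 ∨ s = 3 := by
  fin_cases s <;> simp

/-- **The embedded tensors vanish on occupied dummies ⟹ so does the witness** (`sgf_adapter.embed_modes` writes the
certificate's `d = 2` tensors into the slices `|0⟩, |↑⟩` and zeros into `|↓⟩, |↑↓⟩`). -/
theorem mpsOpenVar_eq_zero_of_dummy (A : Fin N → MPSTensor 4 D) (l r : Fin D → ℂ)
    (hA2 : ∀ j, A j 2 = 0) (hA3 : ∀ j, A j 3 = 0) :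
    ∀ σ : TensorIndex (Fin N) 4, (∃ j, (1 : Fin 2) ∈ siteOcc (σ j)) → mpsOpenVar N A l r σ = 0 := by
  rintro σ ⟨j, hj⟩
  have h0 : A j (σ j) = 0 := by
    rcases (one_mem_siteOcc_iff _).mp hj with h | h
    · rw [h]; exact hA2 j
    · rw [h]; exact hA3 j
  have hprod : (List.ofFn fun j : Fin N => A j (σ j)).prod = 0 :=
    List.prod_eq_zero (List.mem_ofFn.mpr ⟨j, h0⟩)
  unfold mpsOpenVar
  rw [hprod, zero_mulVec, dotProduct_zero]

end Dilation

/-! ## §Q  The dilated operators: second quantisation along `dilOrb`, and the `2ab`-site word sums -/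

section SecondQuantisation

variable {Λ : Type*} [LinearOrder Λ] [Fintype Λ]

omit [LinearOrder Λ] [Fintype Λ] in
/-- Sums over the orbitals are sums over sites and spins (generic orbital set). -/
theorem sum_orb_eq_sum_site_spin {E : Type*} [AddCommMonoid E] (g : Orb Λ → E) [Fintype Λ] :
    ∑ i, g i = ∑ x : Λ, ∑ s : Fin 2, g (orb x s) := by
  rw [← Fintype.sum_prod_type']
  exact (Fintype.sum_equiv toLex (fun p : Λ × Fin 2 => g (orb p.1 p.2)) g fun p => rfl).symm

omit [Fintype Λ] in
/-- **The dilated one-body matrix**: `M` on the spin-`0` orbitals of the dilated lattice, zero on every dummy row and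
column (`sgf_model.ModeQuadModel.dilated`: «mode p ↦ mode 2p; odd modes are dummies, no term touches them»). -/
def dilMatrix (M : Matrix (Orb Λ) (Orb Λ) ℂ) : Matrix (Orb (Orb Λ)) (Orb (Orb Λ)) ℂ :=
  fun i j => if (ofLex i).2 = 0 ∧ (ofLex j).2 = 0 then M (ofLex i).1 (ofLex j).1 else 0

omit [LinearOrder Λ] [Fintype Λ] in
/-- Entries of the dilated matrix on orbitals written `(i, s)`. -/
theorem dilMatrix_orb (M : Matrix (Orb Λ) (Orb Λ) ℂ) (i j : Orb Λ) (s s' : Fin 2) :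
    dilMatrix M (orb i s) (orb j s') = if s = 0 ∧ s' = 0 then M i j else 0 := rfl

omit [LinearOrder Λ] [Fintype Λ] in
/-- A symmetric matrix dilates to a symmetric matrix. -/
theorem dilMatrix_symm (M : Matrix (Orb Λ) (Orb Λ) ℂ) (hM : ∀ i j, M i j = M j i) (i j : Orb (Orb Λ)) :
    dilMatrix M i j = dilMatrix M j i := by
  unfold dilMatrix
  by_cases h1 : (ofLex i).2 = 0 <;> by_cases h2 : (ofLex j).2 = 0 <;> simp [h1, h2, hM]

/-- **`Γ(dilOrb) dΓ(M) = dΓ(dilMatrix M)`** (the second quantisation of an order embedding maps `c†_i c_j` to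
`c†_{(i,0)} c_{(j,0)}`). -/
theorem jwEmbed_dilOrb_dGamma (M : Matrix (Orb Λ) (Orb Λ) ℂ) :
    jwEmbed dilOrb (dGamma M) = dGamma (dilMatrix M) := by
  rw [dGamma_eq, dGamma_eq, map_sum]
  simp only [map_sum, map_smul, map_mul, jwEmbed_creation, jwEmbed_annihilation, dilOrb_apply]
  symm
  rw [sum_orb_eq_sum_site_spin]
  refine Finset.sum_congr rfl fun i _ => ?_
  rw [Fin.sum_univ_two]
  simp only [sum_orb_eq_sum_site_spin (fun j => dilMatrix M (orb i _) j • (creation (orb i _) * annihilation j)),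
    Fin.sum_univ_two, dilMatrix_orb]
  simp

/-- `Γ(dilOrb) n_{xσ} = n_{(xσ), 0}`: a number operator of `Λ` is the spin-`0` number operator of the dilated site
`(x, σ)`. -/
theorem jwEmbed_dilOrb_numberOp (x : Λ) (σ : Fin 2) :
    jwEmbed dilOrb (numberOp x σ) = numberOp (orb x σ) 0 := by
  rw [numberOp, map_mul, jwEmbed_creation, jwEmbed_annihilation]
  rfl

variable {a b : ℕ}

/-- **`Γ(dilOrb)` of the transformed quadratic operator** `dΓ(M) − μ·ab·1 + U(N_↑ − Σ_x n_{x↑}n_{x↓})`: the same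
expression on the dilated lattice with `dilMatrix M`, the spin-`0` number operators of the dilated sites `(x,↑)`, and
the CROSS-site densities `n_{(x↑),0} n_{(x↓),0}`. -/
theorem jwEmbed_dilOrb_quadratic (M : Matrix (Orb (Fin a ×ₗ Fin b)) (Orb (Fin a ×ₗ Fin b)) ℂ) (U μ : ℝ) :
    jwEmbed dilOrb
        (dGamma M - ((μ : ℂ) * ((a : ℂ) * (b : ℂ))) •
            (1 : Matrix (Finset (Orb (Fin a ×ₗ Fin b))) (Finset (Orb (Fin a ×ₗ Fin b))) ℂ) +
          (U : ℂ) • ((∑ x : Fin a ×ₗ Fin b, numberOp x 0) -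
            ∑ x : Fin a ×ₗ Fin b, numberOp x 0 * numberOp x 1)) =
      dGamma (dilMatrix M) - ((μ : ℂ) * ((a : ℂ) * (b : ℂ))) •
          (1 : Matrix (Finset (Orb (Orb (Fin a ×ₗ Fin b)))) (Finset (Orb (Orb (Fin a ×ₗ Fin b)))) ℂ) +
        (U : ℂ) • ((∑ x : Fin a ×ₗ Fin b, numberOp (orb x 0) 0) -
          ∑ x : Fin a ×ₗ Fin b, numberOp (orb x 0) 0 * numberOp (orb x 1) 0) := by
  rw [map_add, map_sub, map_smul, map_smul, map_one, map_sub, map_sum, map_sum, jwEmbed_dilOrb_dGamma]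
  simp only [map_mul, jwEmbed_dilOrb_numberOp]

/-- **`Γ(dilOrb)` of the transformed particle number** `ab·1 + Σ_x (n_{x↑} − n_{x↓})`. -/
theorem jwEmbed_dilOrb_number :
    jwEmbed dilOrb
        (((Fintype.card Λ : ℂ)) • (1 : Matrix (Finset (Orb Λ)) (Finset (Orb Λ)) ℂ) +
          ∑ x : Λ, (numberOp x 0 - numberOp x 1)) =
      ((Fintype.card Λ : ℂ)) • (1 : Matrix (Finset (Orb (Orb Λ))) (Finset (Orb (Orb Λ))) ℂ) +
        ∑ x : Λ, (numberOp (orb x 0) 0 - numberOp (orb x 1) 0) := by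
  rw [map_add, map_smul, map_one, map_sum]
  simp only [map_sub, jwEmbed_dilOrb_numberOp]

end SecondQuantisation

/-! ## §R  The reader's sentence / window for an arbitrary word sum (parts 12/20 + part 3 / part 23) -/

section ReaderWindow

variable {N D : ℕ}

/-- **One-sided**: the `H`-sweep bytes over `quadAutomaton τ ν V`, the `Nrm`-sweep bytes and the two corners of the
by-value ACCEPT test ⟹ `Re⟨ψ, quadWordSum τ ν V ψ⟩ ≤ E·Re⟨ψ,ψ⟩` for the chain witness `ψ = mpsOpenVar N A l r`. -/
theorem wordSum_sentence_of_reader (τ ν : Fin N → Fin 2 → Fin N → Fin 2 → ℂ) (V : Fin N → Matrix (Fin 4) (Fin 4) ℂ)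
    (A : Fin N → MPSTensor 4 D) (l r : Fin D → ℂ) (κ : Fin N → ℝ) (hκ0 : ∀ k, 0 ≤ κ k)
    (hκ : ∀ k (z : EuclideanSpace ℂ (Fin D)), ∑ s, ‖toLp 2 (A k s *ᵥ ofLp z)‖ ^ 2 ≤ κ k * ‖z‖ ^ 2)
    -- the `H`-sweep
    (Mo : Fin N → QState N → QState N → ℝ) (hM0 : ∀ k b' c, 0 ≤ Mo k b' c)
    (hMrow : ∀ k b' c s, ∑ s', ‖quadAutomaton τ ν V k b' c s s'‖ ≤ Mo k b' c)
    (hMcol : ∀ k b' c s', ∑ s, ‖quadAutomaton τ ν V k b' c s s'‖ ≤ Mo k b' c)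
    (YH : Fin (N + 1) → QState N → Matrix (Fin D) (Fin D) ℂ) (ρH : Fin N → QState N → ℝ)
    (hρH : ∀ (k : Fin N) (c : QState N),
      ‖YH k.succ c - ∑ b', transferOp (A k) (quadAutomaton τ ν V k b' c) (YH k.castSucc b')‖ ≤ ρH k c)
    (radH : Fin (N + 1) → QState N → ℝ)
    (hrH0 : ∀ b', ‖YH 0 b' -
      (Pi.single QState.start (vecMulVec (star l) l) : QState N → Matrix (Fin D) (Fin D) ℂ) b'‖ ≤ radH 0 b')
    (hrH : ∀ (k : Fin N) (c : QState N), ∑ b', Mo k b' c * κ k * radH k.castSucc b' + ρH k c ≤ radH k.succ c)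
    -- the `Nrm`-sweep (shared)
    (YN : Fin (N + 1) → Matrix (Fin D) (Fin D) ℂ) (ρN : Fin N → ℝ)
    (hρN : ∀ k : Fin N, ‖YN k.succ - transferOp (A k) 1 (YN k.castSucc)‖ ≤ ρN k)
    (radN : Fin (N + 1) → ℝ) (hrN0 : ‖YN 0 - vecMulVec (star l) l‖ ≤ radN 0)
    (hrN : ∀ k : Fin N, 1 * κ k * radN k.castSucc + ρN k ≤ radN k.succ)
    (E : ℝ)
    -- the two corners of the ACCEPT test
    (hlo : (star r ⬝ᵥ (YH (Fin.last N) QState.fin *ᵥ r)).re +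
        (∑ i, ‖r i‖) * (∑ i, ‖r i‖) * radH (Fin.last N) QState.fin ≤
      (E) * ((star r ⬝ᵥ (YN (Fin.last N) *ᵥ r)).re - (∑ i, ‖r i‖) * (∑ i, ‖r i‖) * radN (Fin.last N)))
    (hhi : (star r ⬝ᵥ (YH (Fin.last N) QState.fin *ᵥ r)).re +
        (∑ i, ‖r i‖) * (∑ i, ‖r i‖) * radH (Fin.last N) QState.fin ≤
      (E) * ((star r ⬝ᵥ (YN (Fin.last N) *ᵥ r)).re + (∑ i, ‖r i‖) * (∑ i, ‖r i‖) * radN (Fin.last N)))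
    :
    (star (mpsOpenVar N A l r) ⬝ᵥ (quadWordSum τ ν V *ᵥ mpsOpenVar N A l r)).re ≤
      E * (star (mpsOpenVar N A l r) ⬝ᵥ mpsOpenVar N A l r).re := by
  have hH := reader_encloses_quadWordSum_element τ ν V A κ hκ0 hκ Mo hM0 hMrow hMcol l l r r YH ρH hρH radH hrH0 hrH
  have hNrm := reader_encloses_productOp_element N A (fun _ => (1 : Matrix (Fin 4) (Fin 4) ℂ)) κ hκ0 hκ
    (fun _ => (1 : ℝ)) (fun _ => zero_le_one) (fun _ s => (sum_norm_one_apply_row s).le)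
    (fun _ s' => (sum_norm_one_apply_col s').le) (1 : Op (Fin N) 4) one_apply_eq_prod_one l l r r YN ρN
    hρN radN hrN0 hrN
  rw [Matrix.one_mulVec] at hNrm
  have hA := abs_re_sub_re_le_of_norm_sub_le hH
  have hB := abs_re_sub_re_le_of_norm_sub_le hNrm
  rw [← one_mul ((star (mpsOpenVar N A l r) ⬝ᵥ (quadWordSum τ ν V *ᵥ mpsOpenVar N A l r)).re)] at hA
  rw [← one_mul E] at hlo hhi
  exact accept_sound one_pos hB hA hlo hhi

/-- **Two-sided**: the same bytes with the four corner tests ⟹ `Elo·Re⟨ψ,ψ⟩ ≤ Re⟨ψ, quadWordSum τ ν V ψ⟩ ≤ Ehi·Re⟨ψ,ψ⟩`. -/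
theorem wordSum_window_of_reader (τ ν : Fin N → Fin 2 → Fin N → Fin 2 → ℂ) (V : Fin N → Matrix (Fin 4) (Fin 4) ℂ)
    (A : Fin N → MPSTensor 4 D) (l r : Fin D → ℂ) (κ : Fin N → ℝ) (hκ0 : ∀ k, 0 ≤ κ k)
    (hκ : ∀ k (z : EuclideanSpace ℂ (Fin D)), ∑ s, ‖toLp 2 (A k s *ᵥ ofLp z)‖ ^ 2 ≤ κ k * ‖z‖ ^ 2)
    -- the `H`-sweep
    (Mo : Fin N → QState N → QState N → ℝ) (hM0 : ∀ k b' c, 0 ≤ Mo k b' c)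
    (hMrow : ∀ k b' c s, ∑ s', ‖quadAutomaton τ ν V k b' c s s'‖ ≤ Mo k b' c)
    (hMcol : ∀ k b' c s', ∑ s, ‖quadAutomaton τ ν V k b' c s s'‖ ≤ Mo k b' c)
    (YH : Fin (N + 1) → QState N → Matrix (Fin D) (Fin D) ℂ) (ρH : Fin N → QState N → ℝ)
    (hρH : ∀ (k : Fin N) (c : QState N),
      ‖YH k.succ c - ∑ b', transferOp (A k) (quadAutomaton τ ν V k b' c) (YH k.castSucc b')‖ ≤ ρH k c)
    (radH : Fin (N + 1) → QState N → ℝ)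
    (hrH0 : ∀ b', ‖YH 0 b' -
      (Pi.single QState.start (vecMulVec (star l) l) : QState N → Matrix (Fin D) (Fin D) ℂ) b'‖ ≤ radH 0 b')
    (hrH : ∀ (k : Fin N) (c : QState N), ∑ b', Mo k b' c * κ k * radH k.castSucc b' + ρH k c ≤ radH k.succ c)
    -- the `Nrm`-sweep (shared)
    (YN : Fin (N + 1) → Matrix (Fin D) (Fin D) ℂ) (ρN : Fin N → ℝ)
    (hρN : ∀ k : Fin N, ‖YN k.succ - transferOp (A k) 1 (YN k.castSucc)‖ ≤ ρN k)
    (radN : Fin (N + 1) → ℝ) (hrN0 : ‖YN 0 - vecMulVec (star l) l‖ ≤ radN 0)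
    (hrN : ∀ k : Fin N, 1 * κ k * radN k.castSucc + ρN k ≤ radN k.succ)
    (Elo Ehi : ℝ)
    -- the four corner tests
    (hlo1 : (Elo) * ((star r ⬝ᵥ (YN (Fin.last N) *ᵥ r)).re - (∑ i, ‖r i‖) * (∑ i, ‖r i‖) * radN (Fin.last N)) ≤
      (star r ⬝ᵥ (YH (Fin.last N) QState.fin *ᵥ r)).re - (∑ i, ‖r i‖) * (∑ i, ‖r i‖) * radH (Fin.last N) QState.fin)
    (hlo2 : (Elo) * ((star r ⬝ᵥ (YN (Fin.last N) *ᵥ r)).re + (∑ i, ‖r i‖) * (∑ i, ‖r i‖) * radN (Fin.last N)) ≤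
      (star r ⬝ᵥ (YH (Fin.last N) QState.fin *ᵥ r)).re - (∑ i, ‖r i‖) * (∑ i, ‖r i‖) * radH (Fin.last N) QState.fin)
    (hhi1 : (star r ⬝ᵥ (YH (Fin.last N) QState.fin *ᵥ r)).re +
        (∑ i, ‖r i‖) * (∑ i, ‖r i‖) * radH (Fin.last N) QState.fin ≤
      (Ehi) * ((star r ⬝ᵥ (YN (Fin.last N) *ᵥ r)).re - (∑ i, ‖r i‖) * (∑ i, ‖r i‖) * radN (Fin.last N)))
    (hhi2 : (star r ⬝ᵥ (YH (Fin.last N) QState.fin *ᵥ r)).re +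
        (∑ i, ‖r i‖) * (∑ i, ‖r i‖) * radH (Fin.last N) QState.fin ≤
      (Ehi) * ((star r ⬝ᵥ (YN (Fin.last N) *ᵥ r)).re + (∑ i, ‖r i‖) * (∑ i, ‖r i‖) * radN (Fin.last N)))
    :
    Elo * (star (mpsOpenVar N A l r) ⬝ᵥ mpsOpenVar N A l r).re ≤
        (star (mpsOpenVar N A l r) ⬝ᵥ (quadWordSum τ ν V *ᵥ mpsOpenVar N A l r)).re ∧
      (star (mpsOpenVar N A l r) ⬝ᵥ (quadWordSum τ ν V *ᵥ mpsOpenVar N A l r)).re ≤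
        Ehi * (star (mpsOpenVar N A l r) ⬝ᵥ mpsOpenVar N A l r).re := by
  have hH := reader_encloses_quadWordSum_element τ ν V A κ hκ0 hκ Mo hM0 hMrow hMcol l l r r YH ρH hρH radH hrH0 hrH
  have hNrm := reader_encloses_productOp_element N A (fun _ => (1 : Matrix (Fin 4) (Fin 4) ℂ)) κ hκ0 hκ
    (fun _ => (1 : ℝ)) (fun _ => zero_le_one) (fun _ s => (sum_norm_one_apply_row s).le)
    (fun _ s' => (sum_norm_one_apply_col s').le) (1 : Op (Fin N) 4) one_apply_eq_prod_one l l r r YN ρN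
    hρN radN hrN0 hrN
  rw [Matrix.one_mulVec] at hNrm
  have hA := abs_re_sub_re_le_of_norm_sub_le hH
  have hB := abs_re_sub_re_le_of_norm_sub_le hNrm
  refine ⟨lower_sound hB hA hlo1 hlo2, ?_⟩
  rw [← one_mul ((star (mpsOpenVar N A l r) ⬝ᵥ (quadWordSum τ ν V *ᵥ mpsOpenVar N A l r)).re)] at hA
  rw [← one_mul Ehi] at hhi1 hhi2
  exact accept_sound one_pos hB hA hhi1 hhi2

end ReaderWindow

end Summit.Ventures.CertifiedManyBodySolver.Upper.IntervalReader

end
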